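import Summits.ValiantsHypothesis.ValiantsHypothesis.Theorems.LacunarySymmetroidMatrixDescartesCensusDoorA34NineInertiaTable
import Summits.ValiantsHypothesis.ValiantsHypothesis.Theorems.LacunarySymmetroidMatrixDescartesCensusMirror

/-!
# `MatrixDescartes` census — DOOR A at `(3,4)`: the NINE-ROW LETTER INERTIA TABLE, part 3 (definite TOP letter, by the mirror `x ↦ x⁻¹`)

HONEST FRAMING.  Object-search cell `pub-symmetroid`, door-A seat `val-sym-door-p3` (g16); helper file beside the OPEN typed statement
`DoorA34 = PosRootLawAt 3 4 18` (route item `Theses.LacunarySymmetroid.DoorA34`, stmt-ValiantsHypothesis-19980), asserted nowhere here.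
Parts 1–2 (`…NineInertia`, `…NineInertiaTable`) give the letter inertias of a `(3,3)` nine-row with a positive definite BOTTOM letter.  The mirror
`x ↦ x⁻¹` (`Census.card_posRoots_det_pencil_mirror`: exponents `d ↦ d₂ − d`, same letters, same number of positive roots) turns a definite TOP
letter into a definite bottom letter on the reversed support `(0, d₂ − d₁, d₂)`, which swaps the chambers `I ↔ IV`, `II ↔ III` of `d₂/d₁`.  Hence,
for a real symmetric pencil `S 0 + X^(d 1) S 1 + X^(d 2) S 2` with `d 0 = 0 < d 1 < d 2`, `S 2 ≻ 0` and NINE distinct positive det-roots: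

* `inertia_top_chamber_I` (`3d₁ < d₂`): `S₁` has inertia `(1,2)`, `S₀` inertia `(2,1)`;
* `inertia_top_chamber_II` (`2d₁ < d₂ < 3d₁`): `S₁` and `S₀` both `(2,1)`;
* `inertia_top_chamber_III` (`3d₁ < 2d₂`, `d₂ < 2d₁`): `S₁` `(1,2)`, `S₀` `(2,1)`;
* `inertia_top_chamber_IV` (`2d₂ < 3d₁`): `−S₁ ≻ 0`, `S₀` `(2,1)`;
* chamber-free: `bottom_letter_inertia_of_top_posDef` (the bottom letter always has inertia `(2,1)`), `middle_letter_not_posDef_of_top_posDef`.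

[(2,1) := `det < 0 ∧ ¬(−S ≻ 0)`, (1,2) := `0 < det ∧ ¬ S ≻ 0`.]  By the global sign `S ↦ −S` (same roots) these cover a NEGATIVE definite top
letter as well (`inertia_top_negDef_chamber_I`: on a chamber-I support such as `(0,1,4)` — the four census nine-rows with a negative definite top letter,
report DOOR-A34-P3G7 §4 — `S₁` has inertia `(2,1)` and `S₀` inertia `(1,2)`).  Nothing here bounds `ζ_sym(3,3)` or `ζ_sym(3,4)`; `DoorA34`, Claim L
and `MatrixDescartes` (stmt-ValiantsHypothesis-18050) stay OPEN; nothing on `VP ≠ VNP`.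
[folklore] `x ↦ x⁻¹` on `(0,∞)`; Descartes' rule (sharp case); spectral theorem; elementary.
-/

open Polynomial Finset Matrix

-- `Summit.ValiantsHypothesis.ValiantsHypothesis.…` repeats a component by the D-0017 layout
-- (single-conjunct summit), which the `dupNamespace` linter flags; the name is mandated.
set_option linter.dupNamespace false

namespace Summit.ValiantsHypothesis.ValiantsHypothesis.Theorems.LacunarySymmetroidMatrixDescartes.Census

namespace NineInertia

open scoped BigOperators Polynomial Matrix

/-! ## 1. The mirrored pencil: exponents `(0, d₂ − d₁, d₂)`, letters `(S 2, S 1, S 0)` -/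

/-- The mirror of `(0, d₁, d₂)` re-sorted: `(d₂ − d₂, d₂ − d₁, d₂ − d₀) = (0, d₂ − d₁, d₂)` with the letters reversed — the two pencils
`∑ X^(d₂ − d l) S l` and `∑ X^(d' l) S' l` are the same polynomial matrix (reindex the three-term sum). [folklore] -/
theorem mirror_sum_three (d : Fin 3 → ℕ) (S : Fin 3 → Matrix (Fin 3) (Fin 3) ℝ) :
    (∑ l, (X : ℝ[X]) ^ (d 2 - d l) • (S l).map C)
      = ∑ l, (X : ℝ[X]) ^ ((![d 2 - d 2, d 2 - d 1, d 2 - d 0] : Fin 3 → ℕ) l) • ((![S 2, S 1, S 0] : Fin 3 → _) l).map C := by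
  simp only [Fin.sum_univ_three, Matrix.cons_val_zero, Matrix.cons_val_one, Matrix.head_cons, Matrix.cons_val_two,
    Matrix.tail_cons]
  abel

/-- **Mirror invariance of the root count** for a sorted three-letter support: the pencil on `(0, d₂ − d₁, d₂)` with letters `(S 2, S 1, S 0)` has
the same number of distinct positive det-roots as the pencil on `d` (`Census.card_posRoots_det_pencil_mirror`, `x ↦ x⁻¹`). [folklore] -/
theorem card_posRoots_mirror_three (d : Fin 3 → ℕ) (S : Fin 3 → Matrix (Fin 3) (Fin 3) ℝ) (h0 : d 0 = 0) (h12 : d 1 < d 2) :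
    ((∑ l, (X : ℝ[X]) ^ ((![0, d 2 - d 1, d 2] : Fin 3 → ℕ) l) • ((![S 2, S 1, S 0] : Fin 3 → _) l).map C).det.roots.toFinset.filter
        (fun t => 0 < t)).card
      = ((∑ l, (X : ℝ[X]) ^ d l • (S l).map C).det.roots.toFinset.filter (fun t => 0 < t)).card := by
  have hd : ∀ l, d l ≤ d 2 := fun l => by fin_cases l <;> simp <;> omega
  have h := card_posRoots_det_pencil_mirror d (d 2) hd S
  rw [mirror_sum_three] at h
  have e : (![d 2 - d 2, d 2 - d 1, d 2 - d 0] : Fin 3 → ℕ) = ![0, d 2 - d 1, d 2] := by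
    rw [h0, Nat.sub_self, Nat.sub_zero]
  rw [e] at h
  exact h

/-- Symmetry of the reversed letters (bookkeeping). [folklore] -/
theorem isSymm_rev (S : Fin 3 → Matrix (Fin 3) (Fin 3) ℝ) (hS : ∀ l, (S l).IsSymm) :
    ∀ l, ((![S 2, S 1, S 0] : Fin 3 → Matrix (Fin 3) (Fin 3) ℝ) l).IsSymm := by
  intro l; fin_cases l
  · exact hS 2
  · exact hS 1
  · exact hS 0

/-! ## 2. THE INERTIA TABLE for a positive definite TOP letter -/

section Top

variable (d : Fin 3 → ℕ) (S : Fin 3 → Matrix (Fin 3) (Fin 3) ℝ)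
  (h9 : 9 ≤ ((Matrix.det (∑ l, ((X : ℝ[X]) ^ d l) • (S l).map C)).roots.toFinset.filter (fun t => 0 < t)).card)
  (h0 : d 0 = 0) (h01 : d 0 < d 1) (h12 : d 1 < d 2) (hP : (S 2).PosDef)
include h9 h0 h12

/-- The mirrored pencil is again a nine-row (bookkeeping). [folklore] -/
theorem nine_le_mirror :
    9 ≤ ((Matrix.det (∑ l, ((X : ℝ[X]) ^ ((![0, d 2 - d 1, d 2] : Fin 3 → ℕ) l)) • (((![S 2, S 1, S 0] : Fin 3 → _) l)).map C)).roots.toFinset.filter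
      (fun t => 0 < t)).card := by
  rw [card_posRoots_mirror_three d S h0 h12]; exact h9

include hP h01

/-- **INERTIA, definite TOP letter, chamber I (`3d₁ < d₂`; mirror chamber IV)**: `S₁` has inertia `(1,2)` (`det S₁ > 0`, `S₁ ⊁ 0`) and the bottom
letter `S₀` inertia `(2,1)` (`det S₀ < 0`, `−S₀ ⊁ 0`). [folklore] -/
theorem inertia_top_chamber_I (hI : 3 * d 1 < d 2) :
    (0 < (S 1).det ∧ ¬ (S 1).PosDef) ∧ ((S 0).det < 0 ∧ ¬ (-S 0).PosDef) := by
  have h9' := nine_le_mirror d S h9 h0 h12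
  have h := inertia_chamber_IV (![0, d 2 - d 1, d 2]) (![S 2, S 1, S 0]) h9' (by simp) (by simpa using hP)
    (by simp; omega) (by simp; omega)
  simpa using h

omit h01 in
/-- **INERTIA, definite TOP letter, chamber II (`2d₁ < d₂ < 3d₁`; mirror chamber III)**: `S₁` and `S₀` both have inertia `(2,1)`. [folklore] -/
theorem inertia_top_chamber_II (hIIa : 2 * d 1 < d 2) (hIIb : d 2 < 3 * d 1) :
    ((S 1).det < 0 ∧ ¬ (-S 1).PosDef) ∧ ((S 0).det < 0 ∧ ¬ (-S 0).PosDef) := by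
  have h9' := nine_le_mirror d S h9 h0 h12
  have h := inertia_chamber_III (![0, d 2 - d 1, d 2]) (![S 2, S 1, S 0]) h9' (by simp) (by simpa using hP)
    (by simp; omega) (by simp; omega)
  simpa using h

omit h01 in
/-- **INERTIA, definite TOP letter, chamber III (`3d₁ < 2d₂`, `d₂ < 2d₁`; mirror chamber II)**: `S₁` has inertia `(1,2)`, `S₀` inertia `(2,1)`. [folklore] -/
theorem inertia_top_chamber_III (hIIIa : 3 * d 1 < 2 * d 2) (hIIIb : d 2 < 2 * d 1) :
    (0 < (S 1).det ∧ ¬ (S 1).PosDef) ∧ ((S 0).det < 0 ∧ ¬ (-S 0).PosDef) := by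
  have h9' := nine_le_mirror d S h9 h0 h12
  have h := inertia_chamber_II (![0, d 2 - d 1, d 2]) (![S 2, S 1, S 0]) h9' (by simp) (by simpa using hP)
    (by simp; omega) (by simp; omega)
  simpa using h

omit h01 in
/-- **INERTIA, definite TOP letter, chamber IV (`d₁ < d₂`, `2d₂ < 3d₁`; mirror chamber I)**: the middle letter is NEGATIVE DEFINITE, `−S₁ ≻ 0`, and
the bottom letter `S₀` has inertia `(2,1)`. [folklore] -/
theorem inertia_top_chamber_IV (hS : ∀ l, (S l).IsSymm) (hIV : 2 * d 2 < 3 * d 1) :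
    (-S 1).PosDef ∧ ((S 0).det < 0 ∧ ¬ (-S 0).PosDef) := by
  have h9' := nine_le_mirror d S h9 h0 h12
  have h := inertia_chamber_I (![0, d 2 - d 1, d 2]) (![S 2, S 1, S 0]) (isSymm_rev S hS) h9' (by simp)
    (by simpa using hP) (by simp; omega) (by simp; omega)
  simpa using h

/-- **Chamber-free row: with a positive definite TOP letter the BOTTOM letter of a nine-row always has inertia `(2,1)`** (`det S₀ < 0`, `−S₀ ⊁ 0`).
[folklore] -/
theorem bottom_letter_inertia_of_top_posDef (hS : ∀ l, (S l).IsSymm) : (S 0).det < 0 ∧ ¬ (-S 0).PosDef := by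
  have h9' := nine_le_mirror d S h9 h0 h12
  have h := top_letter_inertia (![0, d 2 - d 1, d 2]) (![S 2, S 1, S 0]) (isSymm_rev S hS) h9' (by simp)
    (by simpa using hP) (by simp; omega) (by simp; omega)
  simpa using h

/-- **Chamber-free row: with a positive definite TOP letter the MIDDLE letter of a nine-row is never positive definite.** [folklore] -/
theorem middle_letter_not_posDef_of_top_posDef : ¬ (S 1).PosDef := by
  have h9' := nine_le_mirror d S h9 h0 h12
  have h := middle_letter_not_posDef (![0, d 2 - d 1, d 2]) (![S 2, S 1, S 0]) h9' (by simp)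
    (by simpa using hP) (by simp; omega) (by simp; omega)
  simpa using h

end Top

/-! ## 3. A NEGATIVE definite top letter (global sign `S ↦ −S`) -/

/-- The global sign flip `S ↦ −S` multiplies a `3 × 3` pencil determinant by `−1` and keeps its roots (bookkeeping). [folklore] -/
theorem card_posRoots_neg_letters (d : Fin 3 → ℕ) (S : Fin 3 → Matrix (Fin 3) (Fin 3) ℝ) :
    ((Matrix.det (∑ l, ((X : ℝ[X]) ^ d l) • ((fun l => -S l) l).map C)).roots.toFinset.filter (fun t => 0 < t)).card
      = ((Matrix.det (∑ l, ((X : ℝ[X]) ^ d l) • (S l).map C)).roots.toFinset.filter (fun t => 0 < t)).card := by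
  have hsum : (∑ l, ((X : ℝ[X]) ^ d l) • ((fun l => -S l) l).map C) = -(∑ l, ((X : ℝ[X]) ^ d l) • (S l).map C) := by
    rw [← Finset.sum_neg_distrib]
    refine Finset.sum_congr rfl fun l _ => ?_
    rw [Matrix.map_neg _ (map_neg C), smul_neg]
  rw [hsum, Matrix.det_neg, Fintype.card_fin]
  have e : ((-1 : ℝ[X]) ^ 3 * Matrix.det (∑ l, ((X : ℝ[X]) ^ d l) • (S l).map C))
      = -Matrix.det (∑ l, ((X : ℝ[X]) ^ d l) • (S l).map C) := by ring
  rw [e, Polynomial.roots_neg]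

/-- **INERTIA, NEGATIVE definite top letter, chamber I (`3d₁ < d₂`)** — the case of the four census nine-rows with a negative definite top letter on
`(0,1,4)`, `(0,1,6)`, `(0,1,7)` (report DOOR-A34-P3G7 §4): `S₁` has inertia `(2,1)` (`det S₁ < 0`, `−S₁ ⊁ 0`) and `S₀` inertia `(1,2)`
(`det S₀ > 0`, `S₀ ⊁ 0`). [folklore] -/
theorem inertia_top_negDef_chamber_I (d : Fin 3 → ℕ) (S : Fin 3 → Matrix (Fin 3) (Fin 3) ℝ)
    (h9 : 9 ≤ ((Matrix.det (∑ l, ((X : ℝ[X]) ^ d l) • (S l).map C)).roots.toFinset.filter (fun t => 0 < t)).card)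
    (h0 : d 0 = 0) (h01 : d 0 < d 1) (h12 : d 1 < d 2) (hN : (-S 2).PosDef) (hI : 3 * d 1 < d 2) :
    ((S 1).det < 0 ∧ ¬ (-S 1).PosDef) ∧ (0 < (S 0).det ∧ ¬ (S 0).PosDef) := by
  have h9' : 9 ≤ ((Matrix.det (∑ l, ((X : ℝ[X]) ^ d l) • ((fun l => -S l) l).map C)).roots.toFinset.filter (fun t => 0 < t)).card := by
    rw [card_posRoots_neg_letters]; exact h9
  have h := inertia_top_chamber_I d (fun l => -S l) h9' h0 h01 h12 (by simpa using hN) hI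
  simp only [det_neg_fin_three, neg_neg] at h
  obtain ⟨⟨h1, h2⟩, h3, h4⟩ := h
  exact ⟨⟨by linarith, h2⟩, by linarith, h4⟩

end NineInertia

end Summit.ValiantsHypothesis.ValiantsHypothesis.Theorems.LacunarySymmetroidMatrixDescartes.Census
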